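import Literature.Probability.Percolation.ZdFourArmSepGlueProb
import HarnessLib

/-!
# Gluing two well-separated four-arm events down to the unit box (bond percolation on `ℤ²`)

Topic `Literature/Probability/Percolation`; bond percolation on `ℤ²` at `p = 1/2`. PROOFS ONLY (no
definition, no named fact). The case `r = 1` of the gluing step of the quasi-multiplicativity of
the four-arm probability (`DuminilCopinManolescuTassion2021_zdFourArm_quasiMult`,
`ZdFourArmQuasiMult.lean`; Kesten 1987, Lemma 6 with (2.43); Nolin 2008, Prop. 12 (ii), Lemma 13 and
Prop. 17 "arms going up to a single site … a local modification"), companion of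
`real_fourArmTwoClusters_ge_of_sep` (`ZdFourArmSepGlueProb.lean`, inner radius `r ≥ 2`):

* `exists_arms_of_glue_face` — the deterministic gluing of `ZdFourArmSepGlue(Prob).lean` with its
  witnesses exposed (inner landing sites `e = (r, ·)`, `w = (-r, ·)`, the two open connections to
  `S_R` inside `A(r,R)` and the non-connection `e ↮ w` in `A(r,R)`);
* `mem_fourArmTwoClusters_one_of_hub` — at `r = 2` with flat corridors (`h₀ = 0`, so `e = (2,0)`,
  `w = (-2,0)`), if moreover every open edge touching `B(1)` is one of the two rays
  `(±1,0)(±2,0)` and these are open, then `fourArmTwoClusters 1 R` holds: any open path from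
  `(1,0)` to `(-1,0)` in `A(1,R)` is ray · (open walk in `A(2,R)`) · ray;
* `determinedBy_dualFaceCrossing_of`, `apply_one_of_mem_sepEdge_column`,
  `determinedBy_zdFourArmSep_offBox`, `measurableSet_zdFourArmSep` — locality: the glued event at
  `r = 2` with flat corridors is read off the pairs avoiding `B(1)` (a dual corridor of width one
  only crosses the horizontal edges of its column, at rows `≥ 2` or `≤ -2`);
* `real_fourArmTwoClusters_one_ge_of_sep` — hence, with the independent local pattern "the two
  rays are open, every other edge touching `B(1)` is closed" (probability `≥ 2^{-2-|B(2)⁽²⁾|}`),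
  `c⁸ 2^{-2-|B(2)⁽²⁾|} · P(zdFourArmSep n ρ) · P(zdFourArmSep ρ' R) ≤ P(fourArmTwoClusters 1 R)`
  for `128 ≤ n`, `2n ≤ ρ`, `2ρ ≤ ρ'`, `ρ + ρ/8 + 1 ≤ ρ'/2`, `2ρ' ≤ R` and the RSW ratio `k ≥ n`.

## References

* H. Kesten, *Scaling relations for 2D-percolation*, Comm. Math. Phys. 109 (1987), §2, Lemma 6,
  (2.43) [KestenScalingCMP1987].
* P. Nolin, *Near-critical percolation in two dimensions*, EJP 13 (2008), §4.3 Prop. 12, Lemma 13,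
  §4.5 Prop. 17 (arXiv 0711.4948: Prop. 11, Lemma 12, Prop. 16) [Nolin2008].
* H. Duminil-Copin, I. Manolescu, V. Tassion, PTRF 181 (2021), §6.2 Prop. 6.3
  [DuminilCopinManolescuTassion2021].
-/

noncomputable section

open MeasureTheory Set

namespace Literature.Probability.Percolation

open LatticeModels SimpleGraph

/-! ### The deterministic gluing with exposed witnesses -/

section Arms

variable {ω : BondConfig (Site 2)}

set_option maxHeartbeats 4000000 in
/-- **Deterministic gluing with the arms exposed** (same proof as
`mem_fourArmTwoClusters_of_glue_face`, keeping the witnesses): the left end `e` of the inner right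
corridor (`e 0 = r`, `0 ≤ e 1 ≤ h₀`) and the right end `w` of the inner left corridor
(`w 0 = -r`) are joined inside `A(r,R)` to the sphere `S_R` by open paths, and are not joined to
each other inside `A(r,R)` (the dual arms and `not_openConnIn_sqAnnulus_of_dualArmsTB`). [cite: KestenScalingCMP1987, §2 Lemma 6 and (2.43)] [cite: Nolin2008, §4.3 Prop. 12 (ii), proof (arXiv 0711.4948: Prop. 11)] -/
theorem exists_arms_of_glue_face (hω : ω ⊆ (zdGraph 2).edgeSet)
    {r n ρ ρ' R M₀ K₀ M₁ K₁ h₀ h₁ : ℕ}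
    (hr : 2 ≤ r) (hM₀ : r + M₀ + 1 = n) (hK₀ : r + K₀ + 2 = n) (hM₁ : ρ + M₁ + 2 = ρ') (hK₁ : ρ + K₁ + 4 = ρ')
    (hh₀r : h₀ + 1 ≤ r) (hh₀n : h₀ ≤ n / 64) (hh₁r : h₁ + 2 ≤ r) (hh₁n : h₁ ≤ n / 64)
    (hn8 : 1 ≤ n / 8) (hrn : r + n / 8 + 1 ≤ n) (hnρ : n ≤ ρ) (hρ8 : 1 ≤ ρ / 8)
    (hρρ' : ρ + ρ / 8 + 1 ≤ ρ' - ρ' / 8) (hρ'8 : 1 ≤ ρ' / 8) (hρ'R : ρ' + ρ' / 8 ≤ R)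
    (A₁ : ZdSepOpenArmR ω n ρ 0 (0 + (n / 64 : ℕ)) 0 (0 + (ρ / 64 : ℕ)))
    (B₁ : ZdSepOpenArmL ω n ρ 0 (0 + (n / 64 : ℕ)) 0 (0 + (ρ / 64 : ℕ)))
    (D₁ : ZdSepDualArmT ω n ρ 0 (0 + (n / 64 : ℕ)) 0 (0 + (ρ / 64 : ℕ)))
    (E₁ : ZdSepDualArmB ω n ρ 0 (0 + (n / 64 : ℕ)) 0 (0 + (ρ / 64 : ℕ)))
    (A₂ : ZdSepOpenArmR ω ρ' R 0 (0 + (ρ' / 64 : ℕ)) 0 (0 + (R / 64 : ℕ)))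
    (B₂ : ZdSepOpenArmL ω ρ' R 0 (0 + (ρ' / 64 : ℕ)) 0 (0 + (R / 64 : ℕ)))
    (D₂ : ZdSepDualArmT ω ρ' R 0 (0 + (ρ' / 64 : ℕ)) 0 (0 + (R / 64 : ℕ)))
    (E₂ : ZdSepDualArmB ω ρ' R 0 (0 + (ρ' / 64 : ℕ)) 0 (0 + (R / 64 : ℕ)))
    (hT₀R : ω ∈ lrCrossingAt ![(r : ℤ), 0] M₀ h₀)
    (hT₀L : ω ∈ lrCrossingAt ![-((r : ℤ) + M₀), 0] M₀ h₀)
    (hT₁R : ω ∈ lrCrossingAt ![(ρ : ℤ) + 1, 0] M₁ (ρ / 64))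
    (hT₁L : ω ∈ lrCrossingAt ![-((ρ : ℤ) + M₁ + 1), 0] M₁ (ρ / 64))
    (hD₀T : ω ∈ dualFaceCrossing ![0, (r : ℤ)] (h₁ + 1) K₀)
    (hD₀B : ω ∈ dualFaceCrossing ![0, -((r : ℤ) + K₀)] (h₁ + 1) K₀)
    (hD₁T : ω ∈ dualFaceCrossing ![0, (ρ : ℤ) + 2] (ρ / 64 + 1) K₁)
    (hD₁B : ω ∈ dualFaceCrossing ![0, -((ρ : ℤ) + K₁ + 2)] (ρ / 64 + 1) K₁) :
    ∃ e w y₁ y₂ : Site 2, e 0 = r ∧ (0 ≤ e 1 ∧ e 1 ≤ h₀) ∧ w 0 = -(r : ℤ) ∧ (0 ≤ w 1 ∧ w 1 ≤ h₀) ∧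
      y₁ ∈ siteSphere R ∧ y₂ ∈ siteSphere R ∧
      ω ∈ openConnIn (sqAnnulus r R) e y₁ ∧ ω ∈ openConnIn (sqAnnulus r R) w y₂ ∧
      ω ∉ openConnIn (sqAnnulus r R) e w := by
  have hr1 : 1 ≤ r := by omega
  have hdiv₁ : ((ρ / 64 : ℕ) : ℤ) ≤ (ρ' / 64 : ℕ) := by exact_mod_cast Nat.div_le_div_right (by omega)
  have hρR : ρ + ρ / 8 ≤ R := by omega
  have hrρ' : r + ρ' / 8 ≤ ρ' := by omega
  have hdivR : ((R / 64 : ℕ) : ℤ) ≤ R := by exact_mod_cast Nat.div_le_self R 64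
  have hR1 : 1 ≤ R := by omega
  ------------------------------------------------------------------
  -- RIGHT open crossing
  ------------------------------------------------------------------
  obtain ⟨e, y₀, T₀, he0, hy₀, hT₀s, hT₀o⟩ := exists_walk_of_mem_lrCrossingAt hω hT₀R
  simp only [Matrix.cons_val_zero, Matrix.cons_val_one] at he0 hy₀ hT₀s
  obtain ⟨m₀, hm₀, U₀, hU₀s, hU₀o⟩ := A₁.exists_walk_of_innerCorridor hn8 T₀ (by omega) (by omega)
    (fun z hz => ⟨by have := hT₀s z hz; omega, fun _ => by have := hT₀s z hz; omega⟩)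
  obtain ⟨x₁, y₁, T₁, hx₁, hy₁, hT₁s, hT₁o⟩ := exists_walk_of_mem_lrCrossingAt hω hT₁R
  simp only [Matrix.cons_val_zero, Matrix.cons_val_one] at hx₁ hy₁ hT₁s
  obtain ⟨m₁, hm₁, U₁, hU₁s, hU₁o⟩ := A₁.exists_walk_of_outerCorridor hρ8 T₁ (by omega) (by omega)
    (fun z hz => ⟨by have := hT₁s z hz; omega, fun _ => by have := hT₁s z hz; omega⟩)
  obtain ⟨m₂, hm₂, U₂, hU₂s, hU₂o⟩ := A₂.exists_walk_of_innerCorridor_sharp hρ'8 T₁ (by omega) (by omega)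
    (fun z hz => ⟨by have := hT₁s z hz; omega, fun _ => by have := hT₁s z hz; omega⟩)
  obtain ⟨S₀, hS₀s, hS₀e⟩ := exists_walk_within_support T₀ T₀.start_mem_support hm₀
  obtain ⟨S₁, hS₁s, hS₁e⟩ := exists_walk_within_support T₁ hm₁ hm₂
  have okT₀ : ∀ z ∈ T₀.support, z ∈ sqAnnulus r R := fun z hz =>
    mem_sqAnnulus_of_corridorR hr1 (by omega) (by omega) (by omega) (hT₀s z hz)
  have okT₁ : ∀ z ∈ T₁.support, z ∈ sqAnnulus r R := fun z hz =>
    mem_sqAnnulus_of_corridorR hr1 (by omega) (by omega) (by omega) (hT₁s z hz)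
  have okA₁ := A₁.carrier_subset_sqAnnulus hr1 (by omega) hnρ hρR
  have hPR := openWalk_append S₀ (U₀.reverse.append (U₁.append (S₁.append (U₂.reverse.append A₂.W))))
    ⟨fun z hz => okT₀ z (hS₀s z hz), fun e he => hT₀o e (hS₀e e he)⟩
    (openWalk_append _ _ (openWalk_reverse U₀ ⟨fun z hz => okA₁ z (hU₀s z hz), hU₀o⟩)
      (openWalk_append _ _ ⟨fun z hz => okA₁ z (hU₁s z hz), hU₁o⟩
        (openWalk_append _ _ ⟨fun z hz => okT₁ z (hS₁s z hz), fun e he => hT₁o e (hS₁e e he)⟩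
          (openWalk_append _ _
            (openWalk_reverse U₂ ⟨fun z hz => A₂.inner_subset_sqAnnulus hr1 hrρ' hρ'R (hU₂s z hz), hU₂o⟩)
            ⟨fun z hz => sqAnnulus_mono (by omega) le_rfl (A₂.hW z hz), A₂.hWo⟩))))
  have connR : ω ∈ openConnIn (sqAnnulus r R) e A₂.z := mem_openConnIn_of_walk _ hPR.1 hPR.2
  ------------------------------------------------------------------
  -- LEFT open crossing
  ------------------------------------------------------------------
  obtain ⟨xL, w, T₀L, hxL, hw, hT₀Ls, hT₀Lo⟩ := exists_walk_of_mem_lrCrossingAt hω hT₀L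
  simp only [Matrix.cons_val_zero, Matrix.cons_val_one] at hxL hw hT₀Ls
  obtain ⟨m₀L, hm₀L, U₀L, hU₀Ls, hU₀Lo⟩ := B₁.exists_walk_of_innerCorridor hn8 T₀L.reverse (by omega) (by omega)
    (fun z hz => by
      rw [Walk.support_reverse, List.mem_reverse] at hz
      exact ⟨by have := hT₀Ls z hz; omega, fun _ => by have := hT₀Ls z hz; omega⟩)
  obtain ⟨x₁L, y₁L, T₁L, hx₁L, hy₁L, hT₁Ls, hT₁Lo⟩ := exists_walk_of_mem_lrCrossingAt hω hT₁L
  simp only [Matrix.cons_val_zero, Matrix.cons_val_one] at hx₁L hy₁L hT₁Ls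
  obtain ⟨m₁L, hm₁L, U₁L, hU₁Ls, hU₁Lo⟩ := B₁.exists_walk_of_outerCorridor hρ8 T₁L.reverse (by omega) (by omega)
    (fun z hz => by
      rw [Walk.support_reverse, List.mem_reverse] at hz
      exact ⟨by have := hT₁Ls z hz; omega, fun _ => by have := hT₁Ls z hz; omega⟩)
  obtain ⟨m₂L, hm₂L, U₂L, hU₂Ls, hU₂Lo⟩ := B₂.exists_walk_of_innerCorridor_sharp hρ'8 T₁L.reverse (by omega) (by omega)
    (fun z hz => by
      rw [Walk.support_reverse, List.mem_reverse] at hz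
      exact ⟨by have := hT₁Ls z hz; omega, fun _ => by have := hT₁Ls z hz; omega⟩)
  obtain ⟨S₀L, hS₀Ls, hS₀Le⟩ := exists_walk_within_support T₀L.reverse T₀L.reverse.start_mem_support hm₀L
  obtain ⟨S₁L, hS₁Ls, hS₁Le⟩ := exists_walk_within_support T₁L.reverse hm₁L hm₂L
  have okT₀L : ∀ z ∈ T₀L.reverse.support, z ∈ sqAnnulus r R := fun z hz => by
    rw [Walk.support_reverse, List.mem_reverse] at hz
    exact mem_sqAnnulus_of_corridorL hr1 (by omega) (by omega) (by omega) (hT₀Ls z hz)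
  have okT₀Le : ∀ e ∈ T₀L.reverse.edges, e ∈ ω := fun e he => by
    rw [Walk.edges_reverse, List.mem_reverse] at he; exact hT₀Lo e he
  have okT₁L : ∀ z ∈ T₁L.reverse.support, z ∈ sqAnnulus r R := fun z hz => by
    rw [Walk.support_reverse, List.mem_reverse] at hz
    exact mem_sqAnnulus_of_corridorL hr1 (by omega) (by omega) (by omega) (hT₁Ls z hz)
  have okT₁Le : ∀ e ∈ T₁L.reverse.edges, e ∈ ω := fun e he => by
    rw [Walk.edges_reverse, List.mem_reverse] at he; exact hT₁Lo e he
  have okB₁ := B₁.carrier_subset_sqAnnulus hr1 (by omega) hnρ hρR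
  have hPL := openWalk_append S₀L (U₀L.reverse.append (U₁L.append (S₁L.append (U₂L.reverse.append B₂.W))))
    ⟨fun z hz => okT₀L z (hS₀Ls z hz), fun e he => okT₀Le e (hS₀Le e he)⟩
    (openWalk_append _ _ (openWalk_reverse U₀L ⟨fun z hz => okB₁ z (hU₀Ls z hz), hU₀Lo⟩)
      (openWalk_append _ _ ⟨fun z hz => okB₁ z (hU₁Ls z hz), hU₁Lo⟩
        (openWalk_append _ _ ⟨fun z hz => okT₁L z (hS₁Ls z hz), fun e he => okT₁Le e (hS₁Le e he)⟩
          (openWalk_append _ _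
            (openWalk_reverse U₂L ⟨fun z hz => B₂.inner_subset_sqAnnulus hr1 hrρ' hρ'R (hU₂Ls z hz), hU₂Lo⟩)
            ⟨fun z hz => sqAnnulus_mono (by omega) le_rfl (B₂.hW z hz), B₂.hWo⟩))))
  have connL : ω ∈ openConnIn (sqAnnulus r R) w B₂.z := mem_openConnIn_of_walk _ hPL.1 hPL.2
  ------------------------------------------------------------------
  -- TOP dual arm from the face `(c₁ 0, r - 1)` to the level `R`
  ------------------------------------------------------------------
  obtain ⟨aT, bT, W₀, haT, hbT, hW₀s, hW₀c⟩ := hD₀T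
  simp only [Matrix.cons_val_zero, Matrix.cons_val_one] at haT hbT hW₀s
  obtain ⟨c₁, V₀, hc₁1, -, ⟨xT, hxT, hxT0, -⟩, hV₀s, hV₀c, hV₀off⟩ :=
    exists_faceWalk_exit_row_lt W₀ hW₀c r (by omega) (by omega)
  have hc₁0 : 0 ≤ c₁ 0 ∧ c₁ 0 ≤ h₁ := by have := hW₀s xT hxT; omega
  obtain ⟨mT₀, hmT₀, Y₀, -, hY₀c, hY₀f⟩ := D₁.exists_faceWalk_of_innerCorridor hn8 V₀.reverse (by omega) (by omega)
    (fun z hz => by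
      rw [Walk.support_reverse, List.mem_reverse] at hz
      have := hW₀s z (hV₀s z hz)
      exact ⟨by omega, fun _ => by omega⟩)
  obtain ⟨aM, bM, W₁, haM, hbM, hW₁s, hW₁c⟩ := hD₁T
  simp only [Matrix.cons_val_zero, Matrix.cons_val_one] at haM hbM hW₁s
  obtain ⟨mT₁, hmT₁, Y₁, -, hY₁c, hY₁f⟩ := D₁.exists_faceWalk_of_outerCorridor hρ8 W₁.reverse (by omega) (by omega)
    (fun z hz => by
      rw [Walk.support_reverse, List.mem_reverse] at hz
      have := hW₁s z hz
      exact ⟨by omega, fun _ => by omega⟩)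
  obtain ⟨mT₂, hmT₂, Y₂, -, hY₂c, hY₂f⟩ := D₂.exists_faceWalk_of_innerCorridor hρ'8 W₁.reverse (by omega) (by omega)
    (fun z hz => by
      rw [Walk.support_reverse, List.mem_reverse] at hz
      have := hW₁s z hz
      exact ⟨by omega, fun _ => by omega⟩)
  obtain ⟨Z₀, -, hZ₀d⟩ := exists_faceWalk_within_support V₀.reverse V₀.reverse.start_mem_support hmT₀
  obtain ⟨Z₁, -, hZ₁d⟩ := exists_faceWalk_within_support W₁.reverse hmT₁ hmT₂
  have okV₀ : ∀ d ∈ V₀.reverse.darts, sepEdge d.fst d.snd ∉ ω ∧ ∀ v ∈ sepEdge d.fst d.snd, v ∉ box 2 (r - 1) :=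
    faceWalk_reverse V₀ fun d hd => ⟨hV₀c d hd, fun v hv => notMem_box_of_lt_apply 1 (by have := hV₀off d hd v hv; omega)⟩
  have okY₀ := D₁.dartProp_of_fence hr1 hrn hnρ Y₀ hY₀c (fun d hd v hv => Or.inr (hY₀f d hd v hv))
  have okY₁ := D₁.dartProp_of_fence hr1 hrn hnρ Y₁ hY₁c hY₁f
  have okW₁ := faceWalk_reverse W₁ (dartProp_of_rows_ge hr1 (lo := (ρ : ℤ) + 2 - 1) (by omega) W₁ hW₁c
    (fun z hz => (hW₁s z hz).2.2.1))
  have okY₂ := D₂.dartProp_of_fence hr1 (by omega) (by omega) Y₂ hY₂c (fun d hd v hv => Or.inr (hY₂f d hd v hv))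
  have okQ₂ := dartProp_of_body (by omega : r ≤ ρ') hr1 D₂.Q D₂.hQc D₂.hQa
  have hδ₁ := faceWalk_append Z₀ (Y₀.reverse.append (Y₁.append (Z₁.append (Y₂.reverse.append D₂.Q))))
    (faceWalk_of_within _ okV₀ Z₀ hZ₀d)
    (faceWalk_append _ _ (faceWalk_reverse Y₀ okY₀)
      (faceWalk_append _ _ okY₁
        (faceWalk_append _ _ (faceWalk_of_within _ okW₁ Z₁ hZ₁d)
          (faceWalk_append _ _ (faceWalk_reverse Y₂ okY₂) okQ₂))))
  have hgD₂ := D₂.hg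
  ------------------------------------------------------------------
  -- BOTTOM dual arm from the face `(c₂ 0, -r)` to the level `-R-1`
  ------------------------------------------------------------------
  obtain ⟨aB, bB, X₀, haB, hbB, hX₀s, hX₀c⟩ := hD₀B
  simp only [Matrix.cons_val_zero, Matrix.cons_val_one] at haB hbB hX₀s
  obtain ⟨c₂, V₀', hc₂1, -, ⟨xB, hxB, hxB0, -⟩, hV₀'s, hV₀'c, hV₀'off⟩ :=
    exists_faceWalk_exit_row_ge X₀.reverse (forall_darts_reverse_sepEdge_notMem X₀ hX₀c) r (by omega) (by omega)
  have hc₂0 : 0 ≤ c₂ 0 ∧ c₂ 0 ≤ h₁ := by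
    rw [Walk.support_reverse, List.mem_reverse] at hxB
    have := hX₀s xB hxB; omega
  obtain ⟨mB₀, hmB₀, Y₀', -, hY₀'c, hY₀'f⟩ := E₁.exists_faceWalk_of_innerCorridor hn8 V₀'.reverse (by omega) (by omega)
    (fun z hz => by
      rw [Walk.support_reverse, List.mem_reverse] at hz
      have hz' := hV₀'s z hz
      rw [Walk.support_reverse, List.mem_reverse] at hz'
      have := hX₀s z hz'
      exact ⟨by omega, fun _ => by omega⟩)
  obtain ⟨aN, bN, X₁, haN, hbN, hX₁s, hX₁c⟩ := hD₁B
  simp only [Matrix.cons_val_zero, Matrix.cons_val_one] at haN hbN hX₁s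
  obtain ⟨mB₁, hmB₁, Y₁', -, hY₁'c, hY₁'f⟩ := E₁.exists_faceWalk_of_outerCorridor hρ8 X₁ (by omega) (by omega)
    (fun z hz => by have := hX₁s z hz; exact ⟨by omega, fun _ => by omega⟩)
  obtain ⟨mB₂, hmB₂, Y₂', -, hY₂'c, hY₂'f⟩ := E₂.exists_faceWalk_of_innerCorridor hρ'8 X₁ (by omega) (by omega)
    (fun z hz => by have := hX₁s z hz; exact ⟨by omega, fun _ => by omega⟩)
  obtain ⟨Z₀', -, hZ₀'d⟩ := exists_faceWalk_within_support V₀'.reverse V₀'.reverse.start_mem_support hmB₀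
  obtain ⟨Z₁', -, hZ₁'d⟩ := exists_faceWalk_within_support X₁ hmB₁ hmB₂
  have okV₀' : ∀ d ∈ V₀'.reverse.darts, sepEdge d.fst d.snd ∉ ω ∧ ∀ v ∈ sepEdge d.fst d.snd, v ∉ box 2 (r - 1) :=
    faceWalk_reverse V₀' fun d hd =>
      ⟨hV₀'c d hd, fun v hv => notMem_box_of_apply_lt 1 (by have := hV₀'off d hd v hv; omega)⟩
  have okY₀' := E₁.dartProp_of_fence hr1 hrn hnρ Y₀' hY₀'c (fun d hd v hv => Or.inr (hY₀'f d hd v hv))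
  have okY₁' := E₁.dartProp_of_fence hr1 hrn hnρ Y₁' hY₁'c hY₁'f
  have okX₁ := dartProp_of_rows_le hr1 (hi := -((ρ : ℤ) + K₁ + 2) + K₁) (by omega) X₁ hX₁c
    (fun z hz => (hX₁s z hz).2.2.2)
  have okY₂' := E₂.dartProp_of_fence hr1 (by omega) (by omega) Y₂' hY₂'c (fun d hd v hv => Or.inr (hY₂'f d hd v hv))
  have okQ₂' := dartProp_of_body (by omega : r ≤ ρ') hr1 E₂.Q E₂.hQc E₂.hQa
  have hδ₂ := faceWalk_append Z₀' (Y₀'.reverse.append (Y₁'.append (Z₁'.append (Y₂'.reverse.append E₂.Q))))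
    (faceWalk_of_within _ okV₀' Z₀' hZ₀'d)
    (faceWalk_append _ _ (faceWalk_reverse Y₀' okY₀')
      (faceWalk_append _ _ okY₁'
        (faceWalk_append _ _ (faceWalk_of_within _ okX₁ Z₁' hZ₁'d)
          (faceWalk_append _ _ (faceWalk_reverse Y₂' okY₂') okQ₂'))))
  have hgE₂ := E₂.hg
  ------------------------------------------------------------------
  -- assembly
  ------------------------------------------------------------------
  have he1 : 0 ≤ e 1 ∧ e 1 ≤ h₀ := by have := hT₀s e T₀.start_mem_support; omega
  have hw1 : 0 ≤ w 1 ∧ w 1 ≤ h₀ := by have := hT₀Ls w T₀L.end_mem_support; omega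
  have hw' : w 0 = -(r : ℤ) := by omega
  have hzA₂ := A₂.hz
  have hzB₂ := B₂.hz
  have hsep : ω ∉ openConnIn (sqAnnulus r R) e w :=
    not_openConnIn_sqAnnulus_of_dualArmsTB hr (by omega) hω he0 (abs_le.2 ⟨by omega, by omega⟩)
      hw' (abs_le.2 ⟨by omega, by omega⟩)
      _ ⟨by omega, by omega, by omega⟩ (by omega) hδ₁ _ ⟨by omega, by omega, by omega⟩ (by omega) hδ₂
  exact ⟨e, w, A₂.z, B₂.z, he0, he1, hw', hw1,
    mem_siteSphere_of_apply_zero hR1 (Or.inl hzA₂.1) (abs_le.2 ⟨by omega, by omega⟩),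
    mem_siteSphere_of_apply_zero hR1 (Or.inr hzB₂.1) (abs_le.2 ⟨by omega, by omega⟩),
    connR, connL, hsep⟩



/-! ### From the glued arms at `r = 2` and the hub to four arms from the unit box -/

/-- The two rays of the hub, read off an edge touching `B(1)`. [folklore] -/
theorem hub_ray_cases {x y : Site 2} (hx : x ∈ box 2 1)
    (h : s(x, y) = s((![1, 0] : Site 2), ![2, 0]) ∨ s(x, y) = s((![-1, 0] : Site 2), ![-2, 0])) :
    (x = ![1, 0] ∧ y = ![2, 0]) ∨ (x = ![-1, 0] ∧ y = ![-2, 0]) := by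
  rcases h with h | h <;> rcases Sym2.eq_iff.1 h with ⟨rfl, rfl⟩ | ⟨rfl, rfl⟩
  · exact Or.inl ⟨rfl, rfl⟩
  · exact absurd (mem_box.1 hx 0).2 (by norm_num)
  · exact Or.inr ⟨rfl, rfl⟩
  · exact absurd (mem_box.1 hx 0).1 (by norm_num)

/-- **Four arms from the unit box out of the glued arms at `r = 2` and the hub.** If `e = (2,0)`
and `w = (-2,0)` are joined to `S_R` inside `A(2,R)` by open paths and not to each other, the two
rays `(1,0)(2,0)`, `(-1,0)(-2,0)` are open and every open edge with an endpoint in `B(1)` is one of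
them, then `fourArmTwoClusters 1 R` holds with inner sites `(±1, 0)`: an open path of `A(1,R)` from
`(1,0)` to `(-1,0)` starts and ends with the rays and in between never touches `B(1)`, so it would
join `e` to `w` inside `A(2,R)`. (Nolin 2008, Prop. 17: "arms going up to a single site … local
modification"; Kesten 1987, (2.43).) [cite: Nolin2008, §4.5 Prop. 17, proof (arXiv 0711.4948: Prop. 16)] -/
theorem mem_fourArmTwoClusters_one_of_hub (hω : ω ⊆ (zdGraph 2).edgeSet) {R : ℕ}
    {e w y₁ y₂ : Site 2} (he0 : e 0 = 2) (he1 : e 1 = 0) (hw0 : w 0 = -2) (hw1 : w 1 = 0)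
    (hy₁ : y₁ ∈ siteSphere R) (hy₂ : y₂ ∈ siteSphere R)
    (h₁ : ω ∈ openConnIn (sqAnnulus 2 R) e y₁) (h₂ : ω ∈ openConnIn (sqAnnulus 2 R) w y₂)
    (hsep : ω ∉ openConnIn (sqAnnulus 2 R) e w)
    (hrayR : s((![1, 0] : Site 2), ![2, 0]) ∈ ω) (hrayL : s((![-1, 0] : Site 2), ![-2, 0]) ∈ ω)
    (hhub : ∀ ⦃x y : Site 2⦄, s(x, y) ∈ ω → x ∈ box 2 1 →
      s(x, y) = s((![1, 0] : Site 2), ![2, 0]) ∨ s(x, y) = s((![-1, 0] : Site 2), ![-2, 0])) :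
    ω ∈ fourArmTwoClusters 1 R := by
  have he : e = ![2, 0] := by ext i; fin_cases i <;> simp [he0, he1]
  have hw : w = ![-2, 0] := by ext i; fin_cases i <;> simp [hw0, hw1]
  subst he hw
  have hA : sqAnnulus 2 R ⊆ sqAnnulus 1 R := sqAnnulus_mono (by norm_num) le_rfl
  have hR : (2 : ℤ) ≤ R := by
    have h := h₁.1
    rw [mem_sqAnnulus_iff (by norm_num)] at h
    have := (h.1 0).2
    simp only [Matrix.cons_val_zero] at this
    exact_mod_cast this
  have hx₁A : (![1, 0] : Site 2) ∈ sqAnnulus 1 R :=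
    mem_sqAnnulus_of_bounds le_rfl (by simp only [Matrix.cons_val_zero]; omega)
      (by simp only [Matrix.cons_val_zero]; omega) (by simp only [Matrix.cons_val_one, Matrix.cons_val_zero]; omega)
      (by simp only [Matrix.cons_val_one, Matrix.cons_val_zero]; omega) (Or.inl (by simp))
  have hx₂A : (![-1, 0] : Site 2) ∈ sqAnnulus 1 R :=
    mem_sqAnnulus_of_bounds le_rfl (by simp only [Matrix.cons_val_zero]; omega)
      (by simp only [Matrix.cons_val_zero]; omega) (by simp only [Matrix.cons_val_one, Matrix.cons_val_zero]; omega)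
      (by simp only [Matrix.cons_val_one, Matrix.cons_val_zero]; omega) (Or.inr (Or.inl (by simp)))
  have hb₁ : (![1, 0] : Site 2) ∈ box 2 1 := mem_box.2 fun i => by fin_cases i <;> simp
  have hb₂ : (![-1, 0] : Site 2) ∈ box 2 1 := mem_box.2 fun i => by fin_cases i <;> simp
  have hc₁ : ω ∈ openConnIn (sqAnnulus 1 R) ![1, 0] y₁ :=
    PlanarDuality.openConnIn_trans
      (openConnIn_of_adj hx₁A (hA h₁.1) hrayR (fun h => absurd (congrFun h 0) (by norm_num)))
      (openConnIn_mono hA _ _ h₁)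
  have hc₂ : ω ∈ openConnIn (sqAnnulus 1 R) ![-1, 0] y₂ :=
    PlanarDuality.openConnIn_trans
      (openConnIn_of_adj hx₂A (hA h₂.1) hrayL (fun h => absurd (congrFun h 0) (by norm_num)))
      (openConnIn_mono hA _ _ h₂)
  refine ⟨![1, 0], mem_siteSphere_of_apply_zero le_rfl (Or.inl (by simp)) (by simp), ![-1, 0],
    mem_siteSphere_of_apply_zero le_rfl (Or.inr (by simp)) (by simp), y₁, hy₁, y₂, hy₂, hc₁, hc₂, fun hc => hsep ?_⟩
  -- an open path from `(1,0)` to `(-1,0)` inside `A(1,R)`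
  obtain ⟨p, hps, hpe⟩ := exists_walk_of_mem_openConnIn hω hc
  have hqs : ∀ z ∈ p.bypass.support, z ∈ sqAnnulus 1 R := fun z hz => hps z (p.support_bypass_subset_support hz)
  have hqe : ∀ e ∈ p.bypass.edges, e ∈ ω := fun e he => hpe e (p.edges_bypass_subset_edges he)
  have hqp : p.bypass.IsPath := p.bypass_isPath
  generalize p.bypass = q at hqs hqe hqp
  -- its first edge is the right ray
  obtain ⟨v₁, hadj₁, q', rfl⟩ := q.exists_eq_cons_of_ne (fun h => absurd (congrFun h 0) (by norm_num))
  rw [Walk.cons_isPath_iff] at hqp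
  have hv₁ : v₁ = ![2, 0] := by
    have h1 : s((![1, 0] : Site 2), v₁) ∈ ω := hqe _ (by rw [Walk.edges_cons]; exact List.mem_cons_self)
    rcases hub_ray_cases hb₁ (hhub h1 hb₁) with ⟨-, h⟩ | ⟨h, -⟩
    · exact h
    · exact absurd (congrFun h 0) (by norm_num)
  subst hv₁
  -- its last edge is the left ray
  obtain ⟨v₂, hadj₂, q'', hq''⟩ := q'.reverse.exists_eq_cons_of_ne (fun h => absurd (congrFun h 0) (by norm_num))
  have hsupp : ∀ z ∈ q''.support, z ∈ q'.support := fun z hz => by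
    have : z ∈ q'.reverse.support := by rw [hq'', Walk.support_cons]; exact List.mem_cons_of_mem _ hz
    rwa [Walk.support_reverse, List.mem_reverse] at this
  have hedges : ∀ e ∈ (Walk.cons hadj₂ q'').edges, e ∈ q'.edges := fun e he => by
    have : e ∈ q'.reverse.edges := by rw [hq'']; exact he
    rwa [Walk.edges_reverse, List.mem_reverse] at this
  have hq's : ∀ z ∈ q''.support, z ∈ sqAnnulus 1 R := fun z hz =>
    hqs z (by rw [Walk.support_cons]; exact List.mem_cons_of_mem _ (hsupp z hz))
  have hq'e : ∀ e ∈ q''.edges, e ∈ ω := fun e he =>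
    hqe e (by rw [Walk.edges_cons]; exact List.mem_cons_of_mem _ (hedges e (by rw [Walk.edges_cons]; exact List.mem_cons_of_mem _ he)))
  have hv₂ : v₂ = ![-2, 0] := by
    have h1 : s((![-1, 0] : Site 2), v₂) ∈ ω :=
      hqe _ (by rw [Walk.edges_cons]; exact List.mem_cons_of_mem _ (hedges _ (by rw [Walk.edges_cons]; exact List.mem_cons_self)))
    rcases hub_ray_cases hb₂ (hhub h1 hb₂) with ⟨h, -⟩ | ⟨-, h⟩
    · exact absurd (congrFun h 0) (by norm_num)
    · exact h
  subst hv₂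
  have hp'' : q''.IsPath ∧ (![-1, 0] : Site 2) ∉ q''.support := by
    have := hqp.1.reverse
    rw [hq'', Walk.cons_isPath_iff] at this
    exact this
  have h10 : (![1, 0] : Site 2) ∉ q''.support := fun h => hqp.2 (hsupp _ h)
  -- the middle part stays inside `A(2,R)`
  have hq''A : ∀ z ∈ q''.support, z ∈ sqAnnulus 2 R := by
    intro z hz
    have hz1 := hq's z hz
    have hzb : z ∉ box 2 1 := by
      intro hzb
      rcases Walk.mem_support_iff_exists_mem_edges.1 hz with rfl | ⟨e', he', hze'⟩
      · exact absurd (mem_box.1 hzb 0).2 (by norm_num)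
      · obtain ⟨y', rfl⟩ := Sym2.mem_iff_exists.1 hze'
        rcases hub_ray_cases hzb (hhub (hq'e _ he') hzb) with ⟨rfl, -⟩ | ⟨rfl, -⟩
        · exact h10 hz
        · exact hp''.2 hz
    rw [mem_sqAnnulus_iff (by norm_num)] at hz1 ⊢
    refine ⟨hz1.1, ?_⟩
    by_contra hcon
    push Not at hcon
    exact hzb (mem_box.2 fun i => ⟨by have := hcon i; omega, by have := hcon i; omega⟩)
  rw [openConnIn_comm]
  exact mem_openConnIn_of_walk q'' hq''A hq'e


end Arms

/-! ### Locality away from the unit box -/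

section Locality

/-- Locality of the face-walk dual crossing, sharp form: the event is read on the edges crossed
by the steps between faces of its rectangle. [folklore] -/
theorem determinedBy_dualFaceCrossing_of {u : Site 2} {m n' : ℕ} {F : Set (Sym2 (Site 2))}
    (hF : ∀ z z' : Site 2, (u 0 ≤ z 0 ∧ z 0 + 1 ≤ u 0 + m ∧ u 1 - 1 ≤ z 1 ∧ z 1 ≤ u 1 + n') →
      (u 0 ≤ z' 0 ∧ z' 0 + 1 ≤ u 0 + m ∧ u 1 - 1 ≤ z' 1 ∧ z' 1 ≤ u 1 + n') → (zdGraph 2).Adj z z' →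
      sepEdge z z' ∈ F) :
    DeterminedBy (dualFaceCrossing u m n') F := by
  suffices key : ∀ ω ω' : BondConfig (Site 2), ω ∩ F = ω' ∩ F →
      ω' ∈ dualFaceCrossing u m n' → ω ∈ dualFaceCrossing u m n' by
    rw [determinedBy_iff]
    exact fun ω ω' h => ⟨key ω' ω h.symm, key ω ω' h⟩
  rintro ω ω' h ⟨a, b, W, ha, hb, hs, hd⟩
  refine ⟨a, b, W, ha, hb, hs, fun d hd' he => hd d hd' ?_⟩
  have hmem : sepEdge d.fst d.snd ∈ F := hF _ _ (hs _ (W.dart_fst_mem_support_of_mem_darts hd'))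
    (hs _ (W.dart_snd_mem_support_of_mem_darts hd')) d.adj
  exact ((Set.ext_iff.1 h _).1 ⟨he, hmem⟩).1

/-- A step between two faces of one column is vertical, and the crossed (horizontal) edge lies on
the higher of the two rows. [folklore] -/
theorem apply_one_of_mem_sepEdge_column {z z' v : Site 2} (h0 : z' 0 = z 0) (hadj : (zdGraph 2).Adj z z')
    (hv : v ∈ sepEdge z z') : (v 1 = z 1 + 1 ∧ z' 1 = z 1 + 1) ∨ (v 1 = z' 1 + 1 ∧ z 1 = z' 1 + 1) := by
  rcases stepKind_of_adj hadj with ⟨h0', -⟩ | ⟨h0', -⟩ | ⟨h1, h0'⟩ | ⟨h1, h0'⟩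
  · omega
  · omega
  · obtain rfl : z' = z + Pi.single 1 1 := by simp [Site.eq_iff_two, h0', h1]
    rw [sepEdge_up, Sym2.mem_iff] at hv
    refine Or.inl ⟨?_, by simp⟩
    rcases hv with rfl | rfl <;> simp
  · obtain rfl : z = z' + Pi.single 1 1 := by simp [Site.eq_iff_two, h0', h1]
    rw [sepEdge_comm, sepEdge_up, Sym2.mem_iff] at hv
    refine Or.inr ⟨?_, by simp⟩
    rcases hv with rfl | rfl <;> simp

/-- The zones of the well-separated event sit in the box `B(N + N/8 + 1)`. [folklore] -/
theorem determinedBy_zdFourArmSep_box {n N : ℕ} (hn : 128 ≤ n) (hnN : 2 * n ≤ N) :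
    DeterminedBy (zdFourArmSep n N) ↑((box 2 (N + N / 8 + 1)).sym2) := by
  have hb : ∀ x ∈ zdSepZoneR n N ∪ zdSepZoneL n N ∪ (zdSepZoneT n N ∪ zdSepZoneB n N),
      x ∈ box 2 (N + N / 8 + 1) := by
    intro x hx
    have h := (zone_sites hn hnN hx).1
    have h0 := abs_le.1 h.1
    have h1 := abs_le.1 h.2
    rw [mem_box, Fin.forall_fin_two]
    push_cast
    omega
  exact ((determinedBy_zdSepOpenArmR (sym2_subset_coe_sym2 fun x hx => hb x (Or.inl (Or.inl hx)))).inter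
    (determinedBy_zdSepOpenArmL (sym2_subset_coe_sym2 fun x hx => hb x (Or.inl (Or.inr hx))))).inter
    ((determinedBy_zdSepDualArmT (sym2_subset_coe_sym2 fun x hx => hb x (Or.inr (Or.inl hx)))).inter
      (determinedBy_zdSepDualArmB (sym2_subset_coe_sym2 fun x hx => hb x (Or.inr (Or.inr hx)))))

/-- The well-separated event is measurable. [folklore] -/
theorem measurableSet_zdFourArmSep {n N : ℕ} (hn : 128 ≤ n) (hnN : 2 * n ≤ N) :
    MeasurableSet (zdFourArmSep n N) :=
  (determinedBy_zdFourArmSep_box hn hnN).measurableSet_of_finset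

/-- The zones of the well-separated event avoid the unit box. [folklore] -/
theorem notMem_box_one_of_zone {n N : ℕ} (hn : 128 ≤ n) (hnN : 2 * n ≤ N) {x : Site 2}
    (hx : x ∈ zdSepZoneR n N ∪ zdSepZoneL n N ∪ (zdSepZoneT n N ∪ zdSepZoneB n N)) : x ∉ box 2 1 := by
  intro hb
  have h := (zone_sites hn hnN hx).2.1
  have h0 := mem_box.1 hb 0
  have h1 := mem_box.1 hb 1
  push_cast at h0 h1
  rcases h with h | h <;> rcases le_abs.1 h with h | h <;> omega

/-- The well-separated event is read off pairs avoiding the unit box. [folklore] -/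
theorem determinedBy_zdFourArmSep_offBox {n N : ℕ} (hn : 128 ≤ n) (hnN : 2 * n ≤ N) :
    DeterminedBy (zdFourArmSep n N) {e : Sym2 (Site 2) | ∀ x ∈ e, x ∉ box 2 1} := by
  have hF : ∀ Z : Set (Site 2), (∀ x ∈ Z, x ∉ box 2 1) →
      Z.sym2 ⊆ {e : Sym2 (Site 2) | ∀ x ∈ e, x ∉ box 2 1} :=
    fun Z hZ e he x hx => hZ x (Set.mem_sym2_iff_subset.1 he hx)
  exact ((determinedBy_zdSepOpenArmR (hF _ fun x hx => notMem_box_one_of_zone hn hnN (Or.inl (Or.inl hx)))).inter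
    (determinedBy_zdSepOpenArmL (hF _ fun x hx => notMem_box_one_of_zone hn hnN (Or.inl (Or.inr hx))))).inter
    ((determinedBy_zdSepDualArmT (hF _ fun x hx => notMem_box_one_of_zone hn hnN (Or.inr (Or.inl hx)))).inter
      (determinedBy_zdSepDualArmB (hF _ fun x hx => notMem_box_one_of_zone hn hnN (Or.inr (Or.inr hx)))))

end Locality

/-! ### The probability estimate at inner radius one -/

section Probability

open scoped Classical

set_option maxHeartbeats 4000000 in
/-- **Gluing down to the unit box** (Kesten 1987 (2.43); Nolin 2008 Prop. 12 (ii) and Prop. 17,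
"arms going up to a single site": a local modification of bounded cost). With the glued event of
`real_glued_ge` at `r = 2` with flat corridors (`h₀ = h₁ = 0`), which is read off the pairs
avoiding `B(1)`, and the independent local pattern "the two rays `(±1,0)(±2,0)` are open, every
other edge touching `B(1)` is closed" of probability `≥ 2^{-2-|pairs of B(2)|}`:
`c⁸ 2^{-2-|B(2)^{(2)}|} · P(zdFourArmSep n ρ) · P(zdFourArmSep ρ' R) ≤ P(fourArmTwoClusters 1 R)`.
[cite: Nolin2008, §4.3 Prop. 12 (ii) and §4.5 Prop. 17 (arXiv 0711.4948: Prop. 11, Prop. 16)] [cite: KestenScalingCMP1987, §2 Lemma 6, (2.43)] -/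
theorem real_fourArmTwoClusters_one_ge_of_sep {n ρ ρ' R M₀ K₀ M₁ K₁ k : ℕ} {c : ℝ}
    (hM₀ : 2 + M₀ + 1 = n) (hK₀ : 2 + K₀ + 2 = n) (hM₁ : ρ + M₁ + 2 = ρ') (hK₁ : ρ + K₁ + 4 = ρ')
    (hn : 128 ≤ n) (hnρ : 2 * n ≤ ρ) (hρρ' : 2 * ρ ≤ ρ') (hsep : ρ + ρ / 8 + 1 ≤ ρ' / 2) (hρ'R : 2 * ρ' ≤ R)
    (hc0 : 0 < c) (hc : ∀ l : ℕ, 1 ≤ l → c ≤ crossingProb half (k * l - 1) (l - 1))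
    (hkn : n ≤ k) (hkM₁ : M₁ ≤ k * (ρ / 64 + 1) - 1) (hkK₁ : K₁ + 1 ≤ k * (ρ / 64 + 1) - 1) :
    c ^ 8 * (1 / 2) ^ (2 + (box 2 2).sym2.card) *
        ((bondPercolation (zdGraph 2) half).real (zdFourArmSep n ρ) *
          (bondPercolation (zdGraph 2) half).real (zdFourArmSep ρ' R)) ≤
      (bondPercolation (zdGraph 2) half).real (fourArmTwoClusters 1 R) := by
  set μ := bondPercolation (zdGraph 2) half with hμ
  -- the glued event at `r = 2` with flat corridors
  set G : Set (BondConfig (Site 2)) := zdFourArmSep n ρ ∩ zdFourArmSep ρ' R ∩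
    ((lrCrossingAt ![((2 : ℕ) : ℤ), 0] M₀ 0 ∩ lrCrossingAt ![-(((2 : ℕ) : ℤ) + M₀), 0] M₀ 0 ∩
        (lrCrossingAt ![(ρ : ℤ) + 1, 0] M₁ (ρ / 64) ∩ lrCrossingAt ![-((ρ : ℤ) + M₁ + 1), 0] M₁ (ρ / 64))) ∩
      (dualFaceCrossing ![0, ((2 : ℕ) : ℤ)] (0 + 1) K₀ ∩ dualFaceCrossing ![0, -(((2 : ℕ) : ℤ) + K₀)] (0 + 1) K₀ ∩
        (dualFaceCrossing ![0, (ρ : ℤ) + 2] (ρ / 64 + 1) K₁ ∩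
          dualFaceCrossing ![0, -((ρ : ℤ) + K₁ + 2)] (ρ / 64 + 1) K₁))) with hG
  have hGge : c ^ 8 * (μ.real (zdFourArmSep n ρ) * μ.real (zdFourArmSep ρ' R)) ≤ μ.real G :=
    real_glued_ge (r := 2) (h₀ := 0) (h₁ := 0) hM₀ hK₀ hM₁ hK₁ (by norm_num) (by norm_num) hn (by omega) hnρ
      hρρ' hsep hρ'R hc0 hc (by omega) (by omega) hkM₁ hkK₁
  -- the local pattern on the pairs touching `B(1)`
  set rays : Finset (Sym2 (Site 2)) := {s((![1, 0] : Site 2), ![2, 0]), s((![-1, 0] : Site 2), ![-2, 0])} with hrays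
  set Cl : Finset (Sym2 (Site 2)) :=
    ((box 2 2).sym2.filter fun e => e ∈ (zdGraph 2).edgeSet ∧ ∃ x ∈ e, x ∈ box 2 1) \ rays with hCl
  set L : Set (BondConfig (Site 2)) :=
    {ω | (↑rays : Set (Sym2 (Site 2))) ⊆ ω} ∩ {ω | ∀ e ∈ Cl, e ∉ ω} with hL
  have hraysE : ∀ e ∈ rays, e ∈ (zdGraph 2).edgeSet := by
    intro e he
    simp only [hrays, Finset.mem_insert, Finset.mem_singleton] at he
    rcases he with rfl | rfl
    · exact (zdGraph 2).mem_edgeSet.2 ((zdGraph_adj_iff _ _).2 ⟨0, Or.inl (by funext i; fin_cases i <;> simp)⟩)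
    · exact (zdGraph 2).mem_edgeSet.2 ((zdGraph_adj_iff _ _).2 ⟨0, Or.inr (by funext i; fin_cases i <;> simp)⟩)
  have hdetO : DeterminedBy {ω : BondConfig (Site 2) | (↑rays : Set (Sym2 (Site 2))) ⊆ ω} ↑rays := by
    rw [determinedBy_iff]
    intro ω ω' hF
    constructor
    · intro h e he; exact ((Set.ext_iff.1 hF e).1 ⟨h he, he⟩).1
    · intro h e he; exact ((Set.ext_iff.1 hF e).2 ⟨h he, he⟩).1
  have hmeasO : MeasurableSet {ω : BondConfig (Site 2) | (↑rays : Set (Sym2 (Site 2))) ⊆ ω} :=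
    hdetO.measurableSet_of_finset
  have hdisjOC : Disjoint (↑rays : Set (Sym2 (Site 2))) ↑Cl := by
    rw [Finset.disjoint_coe, hCl]
    exact Finset.disjoint_sdiff
  have hindL := bondPercolation_real_inter_of_disjoint (zdGraph 2) half hdisjOC hdetO
    (determinedBy_forall_notMem Cl) hmeasO (measurableSet_forall_notMem Cl)
  have hPO : μ.real {ω : BondConfig (Site 2) | (↑rays : Set (Sym2 (Site 2))) ⊆ ω} = (1 / 2 : ℝ) ^ rays.card := by
    rw [bondPercolation_real_setOf_subset (zdGraph 2) half rays hraysE, coe_half]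
  have hPC : (1 / 2 : ℝ) ^ Cl.card ≤ μ.real {ω : BondConfig (Site 2) | ∀ e ∈ Cl, e ∉ ω} := by
    have := le_bondPercolation_real_forall_notMem (zdGraph 2) half Cl
    rwa [coe_half, show (1 : ℝ) - 1 / 2 = 1 / 2 by norm_num] at this
  have hrays_card : rays.card ≤ 2 := by
    rw [hrays]
    exact (Finset.card_insert_le _ _).trans (by rw [Finset.card_singleton])
  have hCl_card : Cl.card ≤ (box 2 2).sym2.card := by
    rw [hCl]
    exact (Finset.card_le_card Finset.sdiff_subset).trans (Finset.card_filter_le _ _)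
  have hLge : (1 / 2 : ℝ) ^ (2 + (box 2 2).sym2.card) ≤ μ.real L := by
    calc (1 / 2 : ℝ) ^ (2 + (box 2 2).sym2.card) ≤ (1 / 2) ^ rays.card * (1 / 2) ^ Cl.card := by
          rw [pow_add]
          exact mul_le_mul (pow_le_pow_of_le_one (by norm_num) (by norm_num) hrays_card)
            (pow_le_pow_of_le_one (by norm_num) (by norm_num) hCl_card) (by positivity) (by positivity)
      _ ≤ μ.real {ω : BondConfig (Site 2) | (↑rays : Set (Sym2 (Site 2))) ⊆ ω} *
            μ.real {ω : BondConfig (Site 2) | ∀ e ∈ Cl, e ∉ ω} := by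
          rw [hPO]; exact mul_le_mul_of_nonneg_left hPC (by positivity)
      _ = μ.real L := hindL.symm
  -- independence of the glued event and the local pattern
  set F₁ : Set (Sym2 (Site 2)) := {e | ∀ x ∈ e, x ∉ box 2 1} with hF₁
  set F₂ : Set (Sym2 (Site 2)) := {e | ∃ x ∈ e, x ∈ box 2 1} with hF₂
  have hdisj : Disjoint F₁ F₂ := Set.disjoint_left.2 fun e h1 h2 => by
    obtain ⟨x, hx, hxb⟩ := h2
    exact h1 x hx hxb
  have dL : DeterminedBy L F₂ := by
    refine (hdetO.mono fun e he => ?_).inter ((determinedBy_forall_notMem Cl).mono fun e he => ?_)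
    · rw [Finset.mem_coe, hrays, Finset.mem_insert, Finset.mem_singleton] at he
      rcases he with rfl | rfl
      · exact ⟨![1, 0], Sym2.mem_mk_left _ _, mem_box.2 fun i => by fin_cases i <;> simp⟩
      · exact ⟨![-1, 0], Sym2.mem_mk_left _ _, mem_box.2 fun i => by fin_cases i <;> simp⟩
    · rw [Finset.mem_coe, hCl, Finset.mem_sdiff, Finset.mem_filter] at he
      exact he.1.2.2
  have dBp : DeterminedBy (lrCrossingAt ![((2 : ℕ) : ℤ), 0] M₀ 0 ∩ lrCrossingAt ![-(((2 : ℕ) : ℤ) + M₀), 0] M₀ 0 ∩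
      (lrCrossingAt ![(ρ : ℤ) + 1, 0] M₁ (ρ / 64) ∩ lrCrossingAt ![-((ρ : ℤ) + M₁ + 1), 0] M₁ (ρ / 64)))
      ↑(((rectangle M₀ 0).image (· + (![((2 : ℕ) : ℤ), 0] : Site 2))).sym2 ∪
        ((rectangle M₀ 0).image (· + (![-(((2 : ℕ) : ℤ) + M₀), 0] : Site 2))).sym2 ∪
        (((rectangle M₁ (ρ / 64)).image (· + (![(ρ : ℤ) + 1, 0] : Site 2))).sym2 ∪
          ((rectangle M₁ (ρ / 64)).image (· + (![-((ρ : ℤ) + M₁ + 1), 0] : Site 2))).sym2)) :=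
    determinedBy_inter4 (determinedBy_openCrossing_image _ _ _ _) (determinedBy_openCrossing_image _ _ _ _)
      (determinedBy_openCrossing_image _ _ _ _) (determinedBy_openCrossing_image _ _ _ _)
  have dBp' := dBp.mono (show _ ⊆ F₁ from fun e he x hx hb => by
    have hb0 := mem_box.1 hb 0
    push_cast at hb0
    rw [Finset.mem_coe] at he
    simp only [Finset.mem_union] at he
    rcases he with (he | he) | (he | he) <;> have h := apply_le_of_mem_rectanglePairs he hx <;>
      simp only [Matrix.cons_val_zero, Matrix.cons_val_one] at h <;> omega)
  have dT : DeterminedBy (dualFaceCrossing ![0, ((2 : ℕ) : ℤ)] (0 + 1) K₀) F₁ :=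
    determinedBy_dualFaceCrossing_of fun z z' hz hz' hadj x hx hb => by
      have hb1 := mem_box.1 hb 1
      push_cast at hb1
      simp only [Matrix.cons_val_zero, Matrix.cons_val_one] at hz hz'
      rcases apply_one_of_mem_sepEdge_column (by omega) hadj hx with ⟨h1, h2⟩ | ⟨h1, h2⟩ <;> omega
  have dB : DeterminedBy (dualFaceCrossing ![0, -(((2 : ℕ) : ℤ) + K₀)] (0 + 1) K₀) F₁ :=
    determinedBy_dualFaceCrossing_of fun z z' hz hz' hadj x hx hb => by
      have hb1 := mem_box.1 hb 1
      push_cast at hb1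
      simp only [Matrix.cons_val_zero, Matrix.cons_val_one] at hz hz'
      rcases apply_one_of_mem_sepEdge_column (by omega) hadj hx with ⟨h1, h2⟩ | ⟨h1, h2⟩ <;> omega
  have dMT : DeterminedBy (dualFaceCrossing ![0, (ρ : ℤ) + 2] (ρ / 64 + 1) K₁) F₁ :=
    (determinedBy_dualFaceCrossing _ _ _).mono fun e he x hx hb => by
      have hb1 := mem_box.1 hb 1
      push_cast at hb1
      have h := apply_le_of_mem_dualFaceCrossingPairs (Finset.mem_coe.1 he) hx
      simp only [Matrix.cons_val_zero, Matrix.cons_val_one] at h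
      omega
  have dMB : DeterminedBy (dualFaceCrossing ![0, -((ρ : ℤ) + K₁ + 2)] (ρ / 64 + 1) K₁) F₁ :=
    (determinedBy_dualFaceCrossing _ _ _).mono fun e he x hx hb => by
      have hb1 := mem_box.1 hb 1
      push_cast at hb1
      have h := apply_le_of_mem_dualFaceCrossingPairs (Finset.mem_coe.1 he) hx
      simp only [Matrix.cons_val_zero, Matrix.cons_val_one] at h
      omega
  have hρ' : 128 ≤ ρ' := by omega
  have dG : DeterminedBy G F₁ :=
    ((determinedBy_zdFourArmSep_offBox hn hnρ).inter (determinedBy_zdFourArmSep_offBox hρ' hρ'R)).inter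
      (dBp'.inter ((dT.inter dB).inter (dMT.inter dMB)))
  have mG : MeasurableSet G :=
    ((measurableSet_zdFourArmSep hn hnρ).inter (measurableSet_zdFourArmSep hρ' hρ'R)).inter
      ((((measurableSet_lrCrossingAt _ _ _).inter (measurableSet_lrCrossingAt _ _ _)).inter
        ((measurableSet_lrCrossingAt _ _ _).inter (measurableSet_lrCrossingAt _ _ _))).inter
        (((measurableSet_dualFaceCrossing _ _ _).inter (measurableSet_dualFaceCrossing _ _ _)).inter
          ((measurableSet_dualFaceCrossing _ _ _).inter (measurableSet_dualFaceCrossing _ _ _))))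
  have mL : MeasurableSet L := hmeasO.inter (measurableSet_forall_notMem Cl)
  have hind := bondPercolation_real_inter_of_disjoint (zdGraph 2) half hdisj dG dL mG mL
  -- on the intersection the four arms from the unit box occur
  have hincl : μ.real (G ∩ L) ≤ μ.real (fourArmTwoClusters 1 R) := by
    refine ENNReal.toReal_mono (measure_ne_top _ _) (measure_mono_ae ?_)
    have hae : ∀ᵐ ω ∂μ, ω ⊆ (zdGraph 2).edgeSet := ProbabilityTheory.setBernoulli_ae_subset
    filter_upwards [hae] with ω hω h
    obtain ⟨⟨⟨hs₁, hs₂⟩, ⟨⟨hT₀R, hT₀L⟩, ⟨hT₁R, hT₁L⟩⟩, ⟨⟨hD₀T, hD₀B⟩, ⟨hD₁T, hD₁B⟩⟩⟩, hO, hC⟩ := h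
    obtain ⟨⟨⟨A₁⟩, ⟨B₁⟩⟩, ⟨⟨D₁⟩, ⟨E₁⟩⟩⟩ := hs₁
    obtain ⟨⟨⟨A₂⟩, ⟨B₂⟩⟩, ⟨⟨D₂⟩, ⟨E₂⟩⟩⟩ := hs₂
    have hA₁ : Nonempty (ZdSepOpenArmR ω n ρ 0 (0 + (n / 64 : ℕ)) 0 (0 + (ρ / 64 : ℕ))) := by
      simpa only [zero_add] using (⟨A₁⟩ : Nonempty _)
    have hB₁ : Nonempty (ZdSepOpenArmL ω n ρ 0 (0 + (n / 64 : ℕ)) 0 (0 + (ρ / 64 : ℕ))) := by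
      simpa only [zero_add] using (⟨B₁⟩ : Nonempty _)
    have hD₁ : Nonempty (ZdSepDualArmT ω n ρ 0 (0 + (n / 64 : ℕ)) 0 (0 + (ρ / 64 : ℕ))) := by
      simpa only [zero_add] using (⟨D₁⟩ : Nonempty _)
    have hE₁ : Nonempty (ZdSepDualArmB ω n ρ 0 (0 + (n / 64 : ℕ)) 0 (0 + (ρ / 64 : ℕ))) := by
      simpa only [zero_add] using (⟨E₁⟩ : Nonempty _)
    have hA₂ : Nonempty (ZdSepOpenArmR ω ρ' R 0 (0 + (ρ' / 64 : ℕ)) 0 (0 + (R / 64 : ℕ))) := by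
      simpa only [zero_add] using (⟨A₂⟩ : Nonempty _)
    have hB₂ : Nonempty (ZdSepOpenArmL ω ρ' R 0 (0 + (ρ' / 64 : ℕ)) 0 (0 + (R / 64 : ℕ))) := by
      simpa only [zero_add] using (⟨B₂⟩ : Nonempty _)
    have hD₂ : Nonempty (ZdSepDualArmT ω ρ' R 0 (0 + (ρ' / 64 : ℕ)) 0 (0 + (R / 64 : ℕ))) := by
      simpa only [zero_add] using (⟨D₂⟩ : Nonempty _)
    have hE₂ : Nonempty (ZdSepDualArmB ω ρ' R 0 (0 + (ρ' / 64 : ℕ)) 0 (0 + (R / 64 : ℕ))) := by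
      simpa only [zero_add] using (⟨E₂⟩ : Nonempty _)
    obtain ⟨A₁'⟩ := hA₁; obtain ⟨B₁'⟩ := hB₁; obtain ⟨D₁'⟩ := hD₁; obtain ⟨E₁'⟩ := hE₁
    obtain ⟨A₂'⟩ := hA₂; obtain ⟨B₂'⟩ := hB₂; obtain ⟨D₂'⟩ := hD₂; obtain ⟨E₂'⟩ := hE₂
    obtain ⟨e, w, y₁, y₂, he0, he1, hw0, hw1, hy₁, hy₂, h₁, h₂, hsep'⟩ :=
      exists_arms_of_glue_face hω (r := 2) (h₀ := 0) (h₁ := 0) le_rfl hM₀ hK₀ hM₁ hK₁ (by norm_num) (by omega)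
        (by norm_num) (by omega) (by omega) (by omega) (by omega) (by omega) (by omega) (by omega) (by omega)
        A₁' B₁' D₁' E₁' A₂' B₂' D₂' E₂' hT₀R hT₀L hT₁R hT₁L hD₀T hD₀B hD₁T hD₁B
    have hrR : s((![1, 0] : Site 2), ![2, 0]) ∈ ω :=
      hO (by rw [Finset.mem_coe, hrays]; exact Finset.mem_insert_self _ _)
    have hrL : s((![-1, 0] : Site 2), ![-2, 0]) ∈ ω :=
      hO (by rw [Finset.mem_coe, hrays]; exact Finset.mem_insert_of_mem (Finset.mem_singleton_self _))
    refine mem_fourArmTwoClusters_one_of_hub hω (by exact_mod_cast he0) (by omega) (by exact_mod_cast hw0)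
      (by omega) hy₁ hy₂ h₁ h₂ hsep' hrR hrL fun x y hxy hxb => ?_
    -- the hub property: an open edge touching `B(1)` is a ray
    have hE : s(x, y) ∈ (zdGraph 2).edgeSet := hω hxy
    have hadj : (zdGraph 2).Adj x y := (zdGraph 2).mem_edgeSet.1 hE
    have hyb : y ∈ box 2 2 := by
      have h0 := mem_box.1 hxb 0
      have h1 := mem_box.1 hxb 1
      rw [mem_box, Fin.forall_fin_two]
      push_cast at h0 h1 ⊢
      rcases stepKind_of_adj hadj with ⟨h0', h1'⟩ | ⟨h0', h1'⟩ | ⟨h1', h0'⟩ | ⟨h1', h0'⟩ <;> omega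
    have hxb2 : x ∈ box 2 2 := box_mono 2 (by norm_num) hxb
    have hmem : s(x, y) ∈ (box 2 2).sym2.filter fun e => e ∈ (zdGraph 2).edgeSet ∧ ∃ x ∈ e, x ∈ box 2 1 := by
      rw [Finset.mem_filter, Finset.mk_mem_sym2_iff]
      exact ⟨⟨hxb2, hyb⟩, hE, x, Sym2.mem_mk_left _ _, hxb⟩
    by_cases hr : s(x, y) ∈ rays
    · rw [hrays, Finset.mem_insert, Finset.mem_singleton] at hr
      exact hr
    · exact absurd hxy (hC _ (by rw [hCl, Finset.mem_sdiff]; exact ⟨hmem, hr⟩))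
  calc c ^ 8 * (1 / 2) ^ (2 + (box 2 2).sym2.card) * (μ.real (zdFourArmSep n ρ) * μ.real (zdFourArmSep ρ' R))
      = c ^ 8 * (μ.real (zdFourArmSep n ρ) * μ.real (zdFourArmSep ρ' R)) * (1 / 2) ^ (2 + (box 2 2).sym2.card) := by
        ring
    _ ≤ μ.real G * μ.real L := mul_le_mul hGge hLge (by positivity) measureReal_nonneg
    _ = μ.real (G ∩ L) := hind.symm
    _ ≤ μ.real (fourArmTwoClusters 1 R) := hincl

end Probability

end Literature.Probability.Percolation

end
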